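/-
Origin: expansion seat `planner-pub-hodgecm-toy-g2-0`, handover #27 2026-08-18T09:24:22Z (`HOME/pub-hodgecm-toy-g2/lean/ToyG2/Bidegree.lean`, md5 0e13806f, 343 lines);
landed by the gen-7 packager in gate run 27 as `HodgeCM/Model/ToyG2/Bidegree.lean` (import ^import ToyG2\.→import HodgeCM.Model.ToyG2. ×1).
-/
/-
# HodgeCM.Model.ToyG2.Bidegree — the Künneth trace vanishes off the top bidegree (infrastructure for generation 3)

Generation 2 of the `pub-hodgecm-toy` lineage (seat `planner-pub-hodgecm-toy-g2-0`), DESIGN.md §9·RECIPE, lemma (V) and lemma (M).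

(V) `domCoprod_apply_eq_zero_of_card`: a `domCoprod` of pulled-back forms `(α ∘ f) ∧ (β ∘ g)` vanishes on a family `v` whose slots split
into a finset `T` killed by `g` and its complement killed by `f`, as soon as `T.card ≠ card ιa` (pigeonhole over shuffles).  Corollary
`prodForm_eq_zero_of_card`: the exterior product of forms on `H¹(A × B)` vanishes on MIXED families (every entry from `A` or from `B`)
whose number of `A`-entries is not the degree of `α`; hence `trOf_prod_mixed_eq_zero` for the Künneth trace of `Obj₂`.
(M) `span_ιMulti_mixed`: mixed pure wedges span `⋀^k H¹(X × Y)` (multilinear expansion of `u = inl (fst u) + inr (snd u)` slotwise).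
-/
import Mathlib
import Summits.HodgeConjecture.HodgeCM.Model.ToyG2.GysinClass

namespace HodgeCM.ToyG2

open HodgeCM.Toy HodgeCM.Toy.CMPresentation
open Literature.AlgebraicGeometry.Motives
open scoped TensorProduct
open exteriorPower Obj₂

noncomputable section

/-! ### (V) vanishing off-bidegree -/

section DomCoprod

variable {ιa ιb : Type*} [Fintype ιa] [Fintype ιb] [DecidableEq ιa] [DecidableEq ιb]
  {R : Type*} [CommRing R] {M P Q N₁ N₂ : Type*}
  [AddCommGroup M] [Module R M] [AddCommGroup P] [Module R P] [AddCommGroup Q] [Module R Q]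
  [AddCommGroup N₁] [Module R N₁] [AddCommGroup N₂] [Module R N₂]

/-- pigeonhole over shuffles: if the slots of `v` split into `T` (killed by `g`) and `Tᶜ` (killed by `f`) with `T.card ≠ card ιa`,
every shuffle term of `(α ∘ f).domCoprod (β ∘ g)` has a vanishing factor -/
theorem domCoprod_apply_eq_zero_of_card (α : P [⋀^ιa]→ₗ[R] N₁) (β : Q [⋀^ιb]→ₗ[R] N₂)
    (f : M →ₗ[R] P) (g : M →ₗ[R] Q) (v : ιa ⊕ ιb → M) (T : Finset (ιa ⊕ ιb))
    (hg : ∀ t ∈ T, g (v t) = 0) (hf : ∀ t ∉ T, f (v t) = 0) (hT : T.card ≠ Fintype.card ιa) :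
    (α.compLinearMap f).domCoprod (β.compLinearMap g) v = 0 := by
  rw [domCoprod_apply_eq_sum]
  refine Finset.sum_eq_zero fun σ _ => Quotient.inductionOn' σ fun σ => ?_
  rw [domCoprod_summand_mk_apply]
  by_cases hall : ∀ i, σ (Sum.inl i) ∈ T
  · have hinj : Function.Injective (fun i : ιa => σ (Sum.inl i)) :=
      fun i j h => Sum.inl_injective (σ.injective h)
    have himg : (Finset.univ.image fun i : ιa => σ (Sum.inl i)).card = Fintype.card ιa := by
      rw [Finset.card_image_of_injective _ hinj, Finset.card_univ]
    have hsub : (Finset.univ.image fun i : ιa => σ (Sum.inl i)) ⊆ T := by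
      intro t ht
      obtain ⟨i, -, rfl⟩ := Finset.mem_image.1 ht
      exact hall i
    obtain ⟨t, htT, htn⟩ : ∃ t ∈ T, t ∉ Finset.univ.image fun i : ιa => σ (Sum.inl i) := by
      by_contra hne
      push Not at hne
      have hle := Finset.card_le_card (show T ⊆ _ from hne)
      have hge := Finset.card_le_card hsub
      rw [himg] at hle hge
      exact hT (le_antisymm hle hge)
    obtain ⟨j, hj⟩ : ∃ j, σ.symm t = Sum.inr j := by
      rcases hst : σ.symm t with i | j
      · exact absurd (Finset.mem_image.2 ⟨i, Finset.mem_univ _, by rw [← hst, Equiv.apply_symm_apply]⟩) htn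
      · exact ⟨j, rfl⟩
    have hz : (β.compLinearMap g) (fun j' => v (σ (Sum.inr j'))) = 0 := by
      rw [AlternatingMap.compLinearMap_apply]
      refine β.map_coord_zero j ?_
      change g (v (σ (Sum.inr j))) = 0
      rw [← hj, Equiv.apply_symm_apply]
      exact hg t htT
    rw [hz, TensorProduct.tmul_zero, smul_zero]
  · push Not at hall
    obtain ⟨i, hi⟩ := hall
    have hz : (α.compLinearMap f) (fun i' => v (σ (Sum.inl i'))) = 0 := by
      rw [AlternatingMap.compLinearMap_apply]
      exact α.map_coord_zero i (hf _ hi)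
    rw [hz, TensorProduct.zero_tmul, smul_zero]

end DomCoprod

/-- (V) for the exterior product of forms on `H¹(A × B)`: on a MIXED family (slots in `T` carry vectors of `A`, the others vectors of `B`)
with `T.card ≠ m` the product form vanishes -/
theorem prodForm_eq_zero_of_card {A B : Obj} {m n : ℕ} (α : A.L [⋀^Fin m]→ₗ[ℚ] ℚ) (β : B.L [⋀^Fin n]→ₗ[ℚ] ℚ)
    (w : Fin (m + n) → (A.prod B).L) (T : Finset (Fin (m + n)))
    (hT : ∀ r ∈ T, sndL A B (w r) = 0) (hT' : ∀ r ∉ T, fstL A B (w r) = 0) (hc : T.card ≠ m) :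
    prodForm α β w = 0 := by
  have h1 : ∀ t ∈ T.map finSumFinEquiv.symm.toEmbedding, sndL A B ((w ∘ ⇑finSumFinEquiv) t) = 0 := by
    intro t ht
    obtain ⟨r, hr, rfl⟩ := Finset.mem_map.1 ht
    simpa using hT r hr
  have h2 : ∀ t ∉ T.map finSumFinEquiv.symm.toEmbedding, fstL A B ((w ∘ ⇑finSumFinEquiv) t) = 0 := by
    intro t ht
    refine hT' (finSumFinEquiv t) fun hmem => ht ?_
    exact Finset.mem_map.2 ⟨_, hmem, by simp⟩
  have h3 : (T.map finSumFinEquiv.symm.toEmbedding).card ≠ Fintype.card (Fin m) := by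
    rw [Finset.card_map, Fintype.card_fin]
    exact hc
  rw [prodForm, AlternatingMap.domDomCongr_apply, LinearMap.compAlternatingMap_apply,
    domCoprod_apply_eq_zero_of_card α β (fstL A B) (sndL A B) (w ∘ ⇑finSumFinEquiv) _ h1 h2 h3, map_zero]

/-- a family in `H¹(X × Y)` is **mixed along `T`** if the slots in `T` carry vectors of `X` and the others vectors of `Y` -/
def MixedAlong (X Y : Obj₂) {k : ℕ} (w : Fin k → (X.prod Y).L) (T : Finset (Fin k)) : Prop :=
  (∀ r ∈ T, w r ∈ LinearMap.range (X.toObj.inlL Y.toObj)) ∧ (∀ r ∉ T, w r ∈ LinearMap.range (X.toObj.inrL Y.toObj))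

/-- (V) for the Künneth trace: on a mixed family the trace of `X × Y` vanishes unless the number of `X`-slots is `sdeg X` -/
theorem trOf_prod_mixed_eq_zero (X Y : Obj₂) {k : ℕ} (w : Fin k → (X.prod Y).L) (T : Finset (Fin k))
    (hw : MixedAlong X Y w T) (hc : T.card ≠ sdeg X.s X.leaf) :
    trOf (X.prod Y) k (ιMulti ℚ k w) = 0 := by
  by_cases hk : sdeg (X.prod Y).s (X.prod Y).leaf = k
  · rw [trOf_apply_ιMulti hk, form_prod]
    have hk' : sdeg X.s X.leaf + sdeg Y.s Y.leaf = k := hk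
    subst hk'
    have hw' : (w ∘ ⇑(finCongr hk)) = w := by
      funext i
      exact congrArg w (Fin.ext rfl)
    rw [hw']
    refine prodForm_eq_zero_of_card (form X) (form Y) w T (fun r hr => ?_) (fun r hr => ?_) hc
    · obtain ⟨x, hx⟩ := hw.1 r hr
      rw [← hx]
      exact sndL_inlL X.toObj Y.toObj x
    · obtain ⟨y, hy⟩ := hw.2 r hr
      rw [← hy]
      exact fstL_inrL X.toObj Y.toObj y
  · rw [trOf_of_ne hk, LinearMap.zero_apply]

/-! ### (M) mixed pure wedges span -/

/-- (Ported verbatim from the HodgeCMPerL package; no docstring in the source.) -/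
theorem inlL_fstL_add_inrL_sndL (A B : Obj) (x : (A.prod B).L) :
    A.inlL B (fstL A B x) + A.inrL B (sndL A B x) = x := by
  funext u
  rcases u with i | j
  · rw [Pi.add_apply, Obj.inlL_apply_inl, Obj.inrL_apply_inl, add_zero]
    rfl
  · rw [Pi.add_apply, Obj.inlL_apply_inr, Obj.inrL_apply_inr, zero_add]
    rfl

/-- the two pieces of a vector of `H¹(A × B)` -/
def mixedPiece (A B : Obj) (x : (A.prod B).L) : Bool → (A.prod B).L
  | true => A.inlL B (fstL A B x)
  | false => A.inrL B (sndL A B x)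

/-- (Ported verbatim from the HodgeCMPerL package; no docstring in the source.) -/
@[simp] lemma sum_mixedPiece (A B : Obj) (x : (A.prod B).L) : ∑ b : Bool, mixedPiece A B x b = x := by
  rw [Fintype.sum_bool]
  exact inlL_fstL_add_inrL_sndL A B x

/-- (Ported verbatim from the HodgeCMPerL package; no docstring in the source.) -/
theorem mixedAlong_piece (X Y : Obj₂) {k : ℕ} (u : Fin k → (X.prod Y).L) (c : Fin k → Bool) :
    MixedAlong X Y (fun r => mixedPiece X.toObj Y.toObj (u r) (c r)) (Finset.univ.filter fun r => c r = true) := by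
  constructor
  · intro r hr
    have hc : c r = true := (Finset.mem_filter.1 hr).2
    simp only [hc, mixedPiece]
    exact LinearMap.mem_range_self _ _
  · intro r hr
    have hc : c r = false := by
      cases h : c r
      · rfl
      · exact absurd (Finset.mem_filter.2 ⟨Finset.mem_univ r, h⟩) hr
    simp only [hc, mixedPiece]
    exact LinearMap.mem_range_self _ _

/-- (M) **mixed pure wedges span** `⋀^k H¹(X × Y)` -/
theorem span_ιMulti_mixed (X Y : Obj₂) (k : ℕ) :
    Submodule.span ℚ {z : ⋀[ℚ]^k (X.prod Y).L |
      ∃ (w : Fin k → (X.prod Y).L) (T : Finset (Fin k)), MixedAlong X Y w T ∧ z = ιMulti ℚ k w} = ⊤ := by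
  refine le_antisymm le_top ?_
  rw [← exteriorPower.ιMulti_span, Submodule.span_le]
  rintro _ ⟨u, rfl⟩
  have hsum : ιMulti ℚ k u
      = ∑ c : Fin k → Bool, ιMulti ℚ k (fun r => mixedPiece X.toObj Y.toObj (u r) (c r)) := by
    have h := MultilinearMap.map_sum (ιMulti ℚ k (M := (X.prod Y).L)).toMultilinearMap
      (fun r b => mixedPiece X.toObj Y.toObj (u r) b)
    have h2 : (fun i => ∑ j, mixedPiece X.toObj Y.toObj (u i) j) = u :=
      funext fun i => sum_mixedPiece X.toObj Y.toObj (u i)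
    rw [AlternatingMap.coe_multilinearMap, h2] at h
    exact h
  rw [SetLike.mem_coe, hsum]
  exact Submodule.sum_mem _ fun c _ => Submodule.subset_span ⟨_, _, mixedAlong_piece X Y u c, rfl⟩

/-! ### (R) sorting a mixed family -/

/-- (Ported verbatim from the HodgeCMPerL package; no docstring in the source.) -/
theorem eq_inlL_fstL_of_mem_range {A B : Obj} {v : (A.prod B).L} (h : v ∈ LinearMap.range (A.inlL B)) :
    v = A.inlL B (fstL A B v) := by
  obtain ⟨z, rfl⟩ := h
  rw [fstL_inlL]

/-- (Ported verbatim from the HodgeCMPerL package; no docstring in the source.) -/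
theorem eq_inrL_sndL_of_mem_range {A B : Obj} {v : (A.prod B).L} (h : v ∈ LinearMap.range (A.inrL B)) :
    v = A.inrL B (sndL A B v) := by
  obtain ⟨z, rfl⟩ := h
  rw [sndL_inrL]

/-- (R) a mixed family with `i` slots from `X` is a permutation of a SPLIT family `(x₁, …, x_i, y₁, …, y_j)` -/
theorem exists_perm_eq_append_of_mixedAlong (X Y : Obj₂) {i j : ℕ} (w : Fin (i + j) → (X.prod Y).L)
    (T : Finset (Fin (i + j))) (hw : MixedAlong X Y w T) (hT : T.card = i) :
    ∃ (σ : Equiv.Perm (Fin (i + j))) (x : Fin i → X.L) (y : Fin j → Y.L),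
      w ∘ σ = Fin.append (fun a => X.toObj.inlL Y.toObj (x a)) (fun b => X.toObj.inrL Y.toObj (y b)) := by
  have hc1 : Fintype.card {r // r ∈ T} = i := (Fintype.card_of_subtype T fun _ => Iff.rfl).trans hT
  have hc2 : Fintype.card {r // r ∉ T} = j := by
    have h := Fintype.card_subtype_compl (· ∈ T) (α := Fin (i + j))
    simp only [Fintype.card_fin, hc1] at h
    omega
  let e₁ : Fin i ≃ {r // r ∈ T} := (Fintype.equivFinOfCardEq hc1).symm
  let e₂ : Fin j ≃ {r // r ∉ T} := (Fintype.equivFinOfCardEq hc2).symm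
  let σ : Equiv.Perm (Fin (i + j)) :=
    finSumFinEquiv.symm.trans ((e₁.sumCongr e₂).trans (Equiv.sumCompl (· ∈ T)))
  have h1 : ∀ a, σ (Fin.castAdd j a) = ↑(e₁ a) := fun a => by
    simp only [σ, Equiv.trans_apply, finSumFinEquiv_symm_apply_castAdd]
    rfl
  have h2 : ∀ b, σ (Fin.natAdd i b) = ↑(e₂ b) := fun b => by
    simp only [σ, Equiv.trans_apply, finSumFinEquiv_symm_apply_natAdd]
    rfl
  refine ⟨σ, fun a => fstL X.toObj Y.toObj (w (σ (Fin.castAdd j a))),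
    fun b => sndL X.toObj Y.toObj (w (σ (Fin.natAdd i b))), funext fun r => ?_⟩
  induction r using Fin.addCases with
  | left a =>
    rw [Fin.append_left]
    exact eq_inlL_fstL_of_mem_range (hw.1 (σ (Fin.castAdd j a)) (by rw [h1]; exact (e₁ a).2))
  | right b =>
    rw [Fin.append_right]
    exact eq_inrL_sndL_of_mem_range (hw.2 (σ (Fin.natAdd i b)) (by rw [h2]; exact (e₂ b).2))

/-- (R) evaluated: on a mixed family with `sdeg X` slots from `X`, the Künneth trace is `± tr_X · tr_Y` of the sorted parts -/
theorem trOf_prod_mixed (X Y : Obj₂) {i j : ℕ} (hi : sdeg X.s X.leaf = i) (hj : sdeg Y.s Y.leaf = j)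
    (w : Fin (i + j) → (X.prod Y).L) (T : Finset (Fin (i + j))) (hw : MixedAlong X Y w T) (hT : T.card = i) :
    ∃ (σ : Equiv.Perm (Fin (i + j))) (x : Fin i → X.L) (y : Fin j → Y.L),
      w ∘ σ = Fin.append (fun a => X.toObj.inlL Y.toObj (x a)) (fun b => X.toObj.inrL Y.toObj (y b)) ∧
      trOf (X.prod Y) (i + j) (ιMulti ℚ (i + j) w)
        = ((Equiv.Perm.sign σ : ℤ) : ℚ) * (trOf X i (ιMulti ℚ i x) * trOf Y j (ιMulti ℚ j y)) := by
  obtain ⟨σ, x, y, h⟩ := exists_perm_eq_append_of_mixedAlong X Y w T hw hT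
  refine ⟨σ, x, y, h, ?_⟩
  have hperm : ιMulti ℚ (i + j) w = Equiv.Perm.sign σ • ιMulti ℚ (i + j) (w ∘ σ) := by
    rw [AlternatingMap.map_perm, smul_smul, Int.units_mul_self, one_smul]
  rw [hperm, Units.smul_def, map_zsmul, h, trOf_prod_append hi hj, zsmul_eq_mul]

/-! ### (K) the Künneth product of classes and its trace -/

/-- the slots `0, …, i-1` of `Fin (i + j)` -/
def leftSlots (i j : ℕ) : Finset (Fin (i + j)) :=
  (Finset.univ : Finset (Fin i)).map ⟨Fin.castAdd j, Fin.castAdd_injective i j⟩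

/-- (Ported verbatim from the HodgeCMPerL package; no docstring in the source.) -/
lemma card_leftSlots (i j : ℕ) : (leftSlots i j).card = i := by
  rw [leftSlots, Finset.card_map, Finset.card_univ, Fintype.card_fin]

/-- (Ported verbatim from the HodgeCMPerL package; no docstring in the source.) -/
lemma castAdd_mem_leftSlots {i j : ℕ} (a : Fin i) : Fin.castAdd j a ∈ leftSlots i j :=
  Finset.mem_map.2 ⟨a, Finset.mem_univ _, rfl⟩

/-- (Ported verbatim from the HodgeCMPerL package; no docstring in the source.) -/
lemma natAdd_not_mem_leftSlots {i j : ℕ} (b : Fin j) : Fin.natAdd i b ∉ leftSlots i j := by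
  intro h
  obtain ⟨a, -, ha⟩ := Finset.mem_map.1 h
  have hv := congrArg Fin.val ha
  simp only [Function.Embedding.coeFn_mk, Fin.val_castAdd, Fin.val_natAdd] at hv
  omega

/-- a split family is mixed along the left slots -/
theorem mixedAlong_append (X Y : Obj₂) {i j : ℕ} (u : Fin i → X.L) (v : Fin j → Y.L) :
    MixedAlong X Y (Fin.append (fun a => X.toObj.inlL Y.toObj (u a)) (fun b => X.toObj.inrL Y.toObj (v b)))
      (leftSlots i j) := by
  constructor
  · intro r hr
    induction r using Fin.addCases with
    | left a => rw [Fin.append_left]; exact LinearMap.mem_range_self _ _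
    | right b => exact absurd hr (natAdd_not_mem_leftSlots b)
  · intro r hr
    induction r using Fin.addCases with
    | left a => exact absurd (castAdd_mem_leftSlots a) hr
    | right b => rw [Fin.append_right]; exact LinearMap.mem_range_self _ _

/-- the **Künneth product** `a ⊠ b = pr₁^* a ∧ pr₂^* b` of classes of the two factors -/
def kun (X Y : Obj₂) (i j : ℕ) : (⋀[ℚ]^i X.L) →ₗ[ℚ] (⋀[ℚ]^j Y.L) →ₗ[ℚ] ⋀[ℚ]^(i + j) (X.prod Y).L :=
  ((wedge ℚ (X.prod Y).L i j).comp (map i (X.toObj.inlL Y.toObj))).compl₂ (map j (X.toObj.inrL Y.toObj))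

/-- (Ported verbatim from the HodgeCMPerL package; no docstring in the source.) -/
lemma kun_apply (X Y : Obj₂) (i j : ℕ) (a : ⋀[ℚ]^i X.L) (b : ⋀[ℚ]^j Y.L) :
    kun X Y i j a b = wedge ℚ (X.prod Y).L i j (map i (X.toObj.inlL Y.toObj) a) (map j (X.toObj.inrL Y.toObj) b) :=
  rfl

/-- (Ported verbatim from the HodgeCMPerL package; no docstring in the source.) -/
lemma kun_ιMulti (X Y : Obj₂) {i j : ℕ} (u : Fin i → X.L) (v : Fin j → Y.L) :
    kun X Y i j (ιMulti ℚ i u) (ιMulti ℚ j v)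
      = ιMulti ℚ (i + j) (Fin.append (fun a => X.toObj.inlL Y.toObj (u a)) (fun b => X.toObj.inrL Y.toObj (v b))) := by
  rw [kun_apply, map_apply_ιMulti, map_apply_ιMulti, BC.wedge_ιMulti]
  rfl

/-- (K) **trace of a Künneth product**: `tr_{X×Y}(a ⊠ b) = tr_X(a) · tr_Y(b)` in the top bidegree, and `0` in every other bidegree -/
theorem trOf_kun (X Y : Obj₂) (i j : ℕ) (a : ⋀[ℚ]^i X.L) (b : ⋀[ℚ]^j Y.L) :
    trOf (X.prod Y) (i + j) (kun X Y i j a b)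
      = if sdeg X.s X.leaf = i ∧ sdeg Y.s Y.leaf = j then trOf X i a * trOf Y j b else 0 := by
  split_ifs with h
  · have H : (kun X Y i j).compr₂ (trOf (X.prod Y) (i + j))
        = (LinearMap.mul ℚ ℚ).compl₁₂ (trOf X i) (trOf Y j) := by
      refine exteriorPower.linearMap_ext (AlternatingMap.ext fun u => ?_)
      refine exteriorPower.linearMap_ext (AlternatingMap.ext fun v => ?_)
      simp only [LinearMap.compAlternatingMap_apply, LinearMap.compr₂_apply, LinearMap.compl₁₂_apply,
        LinearMap.mul_apply']
      rw [kun_ιMulti, trOf_prod_append h.1 h.2]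
    have := DFunLike.congr_fun (DFunLike.congr_fun H a) b
    simpa only [LinearMap.compr₂_apply, LinearMap.compl₁₂_apply, LinearMap.mul_apply'] using this
  · by_cases hs : sdeg (X.prod Y).s (X.prod Y).leaf = i + j
    · have hi : sdeg X.s X.leaf ≠ i := by
        intro hi
        have hs' : sdeg X.s X.leaf + sdeg Y.s Y.leaf = i + j := hs
        exact h ⟨hi, by omega⟩
      have H : (kun X Y i j).compr₂ (trOf (X.prod Y) (i + j)) = 0 := by
        refine exteriorPower.linearMap_ext (AlternatingMap.ext fun u => ?_)
        refine exteriorPower.linearMap_ext (AlternatingMap.ext fun v => ?_)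
        simp only [LinearMap.compAlternatingMap_apply, LinearMap.compr₂_apply, LinearMap.zero_apply]
        rw [kun_ιMulti]
        exact trOf_prod_mixed_eq_zero X Y _ _ (mixedAlong_append X Y u v) (by rw [card_leftSlots]; exact Ne.symm hi)
      have := DFunLike.congr_fun (DFunLike.congr_fun H a) b
      simpa only [LinearMap.compr₂_apply, LinearMap.zero_apply] using this
    · rw [trOf_of_ne hs, LinearMap.zero_apply]

/-- pulling back a Künneth product: `ψ^*(a ⊠ b) = (ψ ∘ ι₁)^* a ∧ (ψ ∘ ι₂)^* b` -/
theorem map_kun (X Y : Obj₂) {V : Type*} [AddCommGroup V] [Module ℚ V] (ψ : (X.prod Y).L →ₗ[ℚ] V)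
    (i j : ℕ) (a : ⋀[ℚ]^i X.L) (b : ⋀[ℚ]^j Y.L) :
    map (i + j) ψ (kun X Y i j a b)
      = wedge ℚ V i j (map i (ψ ∘ₗ X.toObj.inlL Y.toObj) a) (map j (ψ ∘ₗ X.toObj.inrL Y.toObj) b) := by
  rw [kun_apply, map_wedge, exteriorPower.map_comp, exteriorPower.map_comp]
  rfl

/-! ### (D) representability = killing the left radical (finite-dimensional duality, general form of `GysinClass`) -/

/-- (Ported verbatim from the HodgeCMPerL package; no docstring in the source.) -/
theorem forall_leftRad_of_repr {X : Obj₂} {i j : ℕ} {lam : (⋀[ℚ]^i X.L) →ₗ[ℚ] ℚ} {c : ⋀[ℚ]^j X.L}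
    (hc : ∀ y, lam y = trOf X (i + j) (wedge ℚ X.L i j y c)) : ∀ y ∈ leftRad X i j, lam y = 0 := by
  intro y hy
  rw [hc y]
  exact (mem_leftRad.1 hy) c

/-- (D) a functional on `⋀^i H¹(X)` is of the form `tr_X(· ∧ c)` iff it kills the left radical of the trace pairing -/
theorem exists_repr_of_forall_leftRad {X : Obj₂} {i j : ℕ} (lam : (⋀[ℚ]^i X.L) →ₗ[ℚ] ℚ)
    (h : ∀ y ∈ leftRad X i j, lam y = 0) :
    ∃ c : ⋀[ℚ]^j X.L, ∀ y, lam y = trOf X (i + j) (wedge ℚ X.L i j y c) := by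
  haveI : Module.Free ℚ (↥(⋀[ℚ]^j X.L)) := Module.Free.of_divisionRing ℚ _
  haveI : Module.Finite ℚ (↥(⋀[ℚ]^j X.L)) := exteriorPower.instFinite
  haveI : Module.IsReflexive ℚ (↥(⋀[ℚ]^j X.L)) := Module.IsReflexive.of_finite_of_free ℚ _
  have hmem : lam ∈ (LinearMap.ker (trPairing X i j)).dualAnnihilator := by
    rw [Submodule.mem_dualAnnihilator]
    exact h
  rw [← LinearMap.range_dualMap_eq_dualAnnihilator_ker, LinearMap.mem_range] at hmem
  obtain ⟨ψ, hψ⟩ := hmem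
  refine ⟨(Module.evalEquiv ℚ _).symm ψ, fun y => ?_⟩
  have hy := LinearMap.congr_fun hψ y
  rw [LinearMap.dualMap_apply] at hy
  rw [← hy, ← trPairing_apply]
  exact (Module.apply_evalEquiv_symm_apply ℚ _ _ ψ).symm

end

end HodgeCM.ToyG2
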